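import Summits.BirchSwinnertonDyer.BirchSwinnertonDyer.Theorems.SignedLowerHalvesSmallImageLowerHalfBothSignsRttD2SeqSemilocPT
import Summits.BirchSwinnertonDyer.BirchSwinnertonDyer.Theorems.SignedLowerHalvesSmallImageLowerHalfBothSignsRttD2SeqSemilocMap
import Summits.BirchSwinnertonDyer.BirchSwinnertonDyer.Theorems.SignedLowerHalvesSmallImageLowerHalfBothSignsRttD2SeqJ3Konig
import Summits.BirchSwinnertonDyer.BirchSwinnertonDyer.Theorems.SignedLowerHalvesSmallImageLowerHalfBothSignsRttD2SeqJ3HLayerSolve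
import Summits.BirchSwinnertonDyer.BirchSwinnertonDyer.Theorems.SignedLowerHalvesSmallImageLowerHalfBothSignsRttD2SeqJ3Finite
import HarnessLib

/-!
# Route `SignedLowerHalves`, crux L `SmallImageLowerHalfBothSigns` (stmt-BirchSwinnertonDyer-23599), line `rtt_w3` v26 — stub S3β (`stub_junctionPT_ns`, row J4′,
# Poitou–Tate half; shared with S3α's brick α5), brick T4 = THE TOWER PASSAGE OF POITOU–TATE AT THE DEPLETED PLACES:
# a family of SEMILOCAL IWASAWA classes `h = (h_w)_{w ∈ S₀} ∈ ⊕_w 𝐇¹_{Iw,w}` which is levelwise orthogonal to the `v`-strict dual layer classes, and levelwise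
# unramified at the places of `S₀ ∖ P`, IS the semilocalisation `sloc b` of a class `b ∈ I.H` of honda's cyclotomic Iwasawa module over `P`

WIDTH seat `bsd-line-slh-p3-w3` g25 under LEAD `cruxlead-stmt-BirchSwinnertonDyer-23599` g13 (cell `bsd-ssimc`); helper `--supports stmt-BirchSwinnertonDyer-23599`
(design memo `Lines/rtt_w3-DESIGN-S3beta-w3-g25.md`, §4 N1 + N4). DEFINITIONS WITH BODIES (`layerReps`, `pairingB`, `semilocDual`, `semilocPairNK`) + THEOREMS; no named fact,
no instance, no `sorry`. HONEST FRAMING: this is the compactness/bookkeeping passage `finite level ⟹ tower` of the depleted Poitou–Tate existence statement; the LEVELWISE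
orthogonality is a HYPOTHESIS (`horth`, to be supplied by the semilocal tower pairing against `Sel_{str,v}`, bricks N2/N3 of the memo); S3β, E2, crux L and BSD remain OPEN
and are proved for NO curve.

WHAT.
* §1 `layerReps κ n` — a fixed system of representatives of `Γ_K ⧸ U_n` with `s(1) = 1` (the Shapiro lift does not depend on it, `shapiroLift_eq_of_reps`, but the tree's
  `shapiroLift` takes one); `pairingB PG k` — honda's level pairing `X_k × M[p^k] → μ_{p^k}` as a bi-additive map, `pairingB_smul` its equivariance;
  `semilocDual … w n k c = loc_w(H¹(Ψ_{n,k})(Sh_{U_n} c))` — THE SEMILOCAL DUAL CLASS at `w` of a global layer class `c ∈ H¹(U_n, M[p^k])` (`Ψ = coindTateDualMor`), and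
  `semilocPairNK … w n k t c = ⟨t, semilocDual c⟩_w` — the canonical local Tate pairing of level `(n, k)` at `w` (T3-finite's currency, named).
* §2 ★★ `exists_cycLayer_forall_semilocNK_eq_of_orth` (N1, ONE LEVEL `(n, k)`, honda's dialect): if `t = (t_w)_w`, `t_w ∈ Lloc_w(n,k)`, is orthogonal (`Σ_{w∈S₀} ⟨t_w, semilocDual c⟩_w = 0`)
  to every `c ∈ H¹(U_n, M[p^k])` unramified off `S₀ ∪ {v}` whose dual class is orthogonal to everything at `v`, and `t_w` is an unramified local class at every `w ∈ S₀ ∖ P`,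
  then `t_w = sloc_{w,n,k} yb` (`w ∈ S₀`) for some `yb ∈ G_{n,k} = H¹(G_P(K_n), X_k)`: T3-finite (`exists_layer_forall_localization_shapiroLift_eq`, p811420) on
  `X = X_k`, `A = M[p^k]`, `U = U_n`, then the class-level unramified transport at `S₀ ∖ P` (`PTDeep.resLe_inertia_eq_zero_of_localization_shapiroLift_mem`) and honda's
  descent H1 (`exists_inflNK_eq_of_resLe_inertia`), read through T1-a's `semilocNK_eq_map_shapiroLift`.
* §3 ★★★ `exists_forall_semilocMap_eq_of_forall_orth` (N4, THE TOWER): for honda's `I` and the semilocal data `L_w` (T1-b₂), a family `h_w ∈ L_w.H` (`w ∈ S₀`) whose level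
  projections satisfy the hypotheses of §2 at every level is `sloc_w b` (`semilocMap`, T2) for ONE `b ∈ I.H`, simultaneously for all `w ∈ S₀`: the levelwise solution sets are
  non-empty (§2), finite and closed under the transitions (T1-b₁ `semilocNK_cores/_red` + (P1)/(P2) of `L_w`), so Kőnig's lemma over the layer groups (g22's
  `LayerPairing.exists_proj_mem_of_forall_nonempty`, p783849, run on any finite-level socket `𝓛`) gives `b`, and (P3) of `L_w` identifies `sloc_w b = h_w`.
References: [MilneADT2006] I Thm. 4.10 (b); [NeukirchSchmidtWingberg2008] I §6 (1.6.4), (8.6.2)–(8.6.3); [Rubin2000] Thm. 1.7.3, Prop. B.1.1, App. B.3; [Kato2004Asterisque] §8.2, §17.13;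
[Kobayashi2003] Thm. 7.3 i); [PerrinRiou1994Invent] §1.3.
-/

set_option autoImplicit false
set_option linter.dupNamespace false -- D-0017: single-problem summit, the namespace repeats the problem name by design
noncomputable section

open scoped Classical
open CategoryTheory Function NumberField IsDedekindDomain Field

namespace Summit.BirchSwinnertonDyer.BirchSwinnertonDyer.Theorems.SmallImageRttD2Seq

open Literature.NumberTheory.GaloisRepresentations Literature.NumberTheory.GaloisCohomology Literature.NumberTheory.EllipticCurves
  Literature.NumberTheory.ComplexMultiplication.EllipticUnits Literature.NumberTheory.ComplexMultiplication.EllipticUnits.JohnsonLeungKings2011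
  Literature.NumberTheory.GaloisRepresentations.DiscreteGaloisModule Literature.NumberTheory.GaloisCohomology.PoitouTateFinite
  Summit.BirchSwinnertonDyer.BirchSwinnertonDyer.Theorems.SmallImageRttD2J1

/-! ## §1. Representatives, the level pairing as a bi-additive map, the semilocal dual class and the semilocal level pairing -/

section Reps

variable {K : Type} [Field K] [NumberField K] {p : ℕ} [Fact p.Prime] (κ : ZpExtension K p)

/-- **A fixed system of representatives of `Γ_K ⧸ U_n` with `s(1·U_n) = 1`** (choice; the Shapiro lift on classes does not depend on it, `shapiroLift_eq_of_reps`).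
[cite: NeukirchSchmidtWingberg2008, I §6 Prop. (1.6.4)] -/
def layerReps (n : ℕ) : absoluteGaloisGroup K ⧸ κ.layerSubgroup n → absoluteGaloisGroup K :=
  Classical.choose (exists_reps_one (G := absoluteGaloisGroup K) (N := κ.layerSubgroup n))

omit [NumberField K] in
/-- `layerReps` is a section of the quotient map. [folklore] -/
theorem layerReps_spec (n : ℕ) (x : absoluteGaloisGroup K ⧸ κ.layerSubgroup n) : (layerReps κ n x : absoluteGaloisGroup K ⧸ κ.layerSubgroup n) = x :=
  (Classical.choose_spec (exists_reps_one (G := absoluteGaloisGroup K) (N := κ.layerSubgroup n))).1 x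

omit [NumberField K] in
/-- `layerReps` sends the identity coset to `1`. [folklore] -/
theorem layerReps_one (n : ℕ) : layerReps κ n ((1 : absoluteGaloisGroup K) : absoluteGaloisGroup K ⧸ κ.layerSubgroup n) = 1 :=
  (Classical.choose_spec (exists_reps_one (G := absoluteGaloisGroup K) (N := κ.layerSubgroup n))).2

end Reps

section Pairing

variable {K : Type} [Field K] [NumberField K] {p : ℕ} [Fact p.Prime] (S : Set (PadicAlgCl p)) [FiniteDimensional ℚ_[p] (padicCoeffField S)] (κ : ZpExtension K p)
  (θ' : absoluteGaloisGroup K →ₜ* (padicCoeffIntegers S)ˣ) (P : Set (HeightOneSpectrum (𝓞 K)))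
  (M : Type) [AddCommGroup M] [TopologicalSpace M] [DiscreteTopology M] [DistribMulAction (absoluteGaloisGroup K) M] [Module (padicCoeffIntegers S) M]
  (hstabK : ∀ m : M, IsOpen (MulAction.stabilizer (absoluteGaloisGroup K) m : Set (absoluteGaloisGroup K)))
  (PG : ∀ k : ℕ, ContPairing (coeffRepK S θ' P k).toTopRep (torsRep M hstabK p k).toTopRep (mu K (p ^ k)).toTopRep)

/-- **honda's level pairing `X_k × M[p^k] → μ_{p^k}` as a bi-additive map** (the `B` of the coinduced Tate-dual morphism `Ψ = coindTateDualMor`). [cite: MilneADT2006, Ch. I, Cor. 2.3] -/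
def pairingB (k : ℕ) :
    ↥(Representation.invariants ((muTwistO S θ' k).toRepresentation.comp (ramificationSubgroup K P).subtype)) →+ ↥(torsionPow M p k) →+ MuCarrier K (p ^ k) :=
  LinearMap.toAddMonoidHom'.comp (PG k).toLin.toAddMonoidHom

omit [NumberField K] [FiniteDimensional ℚ_[p] (padicCoeffField S)] [Module (padicCoeffIntegers S) M] in
/-- Unfolding `pairingB`. [folklore] -/
theorem pairingB_apply (k : ℕ) (x : ↥(Representation.invariants ((muTwistO S θ' k).toRepresentation.comp (ramificationSubgroup K P).subtype))) (a : ↥(torsionPow M p k)) :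
    pairingB S θ' P M hstabK PG k x a = (PG k).toLin x a :=
  rfl

omit [NumberField K] [FiniteDimensional ℚ_[p] (padicCoeffField S)] [Module (padicCoeffIntegers S) M] in
/-- `pairingB` is `Γ_K`-equivariant into `μ_{p^k}`. [cite: MilneADT2006, Ch. I, Cor. 2.3] -/
theorem pairingB_smul (k : ℕ) (σ : absoluteGaloisGroup K)
    (x : ↥(Representation.invariants ((muTwistO S θ' k).toRepresentation.comp (ramificationSubgroup K P).subtype))) (a : ↥(torsionPow M p k)) :
    pairingB S θ' P M hstabK PG k (coeffRepK S θ' P k σ x) (torsRep M hstabK p k σ a) = mu K (p ^ k) σ (pairingB S θ' P M hstabK PG k x a) :=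
  (PG k).toLin_smul σ x a

omit [NumberField K] [FiniteDimensional ℚ_[p] (padicCoeffField S)] [Module (padicCoeffIntegers S) M] in
/-- Perfectness of `PG k` on the `M[p^k]`-side gives bijectivity of `a ↦ B(·, a)`. [cite: MilneADT2006, Ch. I, Cor. 2.3] -/
theorem bijective_pairingB_flip (k : ℕ) (hperf : Bijective fun a : ↥(torsionPow M p k) ↦ (PG k).toLin.flip a) :
    Bijective fun a : ↥(torsionPow M p k) ↦ (pairingB S θ' P M hstabK PG k).flip a := by
  constructor
  · intro a a' h
    apply hperf.1
    exact LinearMap.ext fun x ↦ (DFunLike.congr_fun h x :)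
  · intro f
    obtain ⟨a, ha⟩ := hperf.2 f.toIntLinearMap
    exact ⟨a, AddMonoidHom.ext fun x ↦ (LinearMap.congr_fun ha x :)⟩

/-- **THE SEMILOCAL DUAL CLASS at `w` of a global layer class** `c ∈ H¹(U_n, M[p^k])`: `loc_w(H¹(Ψ_{n,k})(Sh_{U_n} c)) ∈ H¹(K_w, Maps(Γ_K ⧸ U_n, X_k)^D)` — by Mackey the vector of
the localisations of `c` at all places of `K_n` above `w`, moved to the Tate dual of the coinduced module by honda's perfect level pairing. [cite: NeukirchSchmidtWingberg2008, (8.6.2)]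
[cite: MilneADT2006, Ch. I, Cor. 2.3] -/
def semilocDual (w : HeightOneSpectrum (𝓞 K)) (n k : ℕ) (c : continuousCohomology 1 (subgroupRep (torsRep M hstabK p k).toTopRep (κ.layerSubgroup n))) :
    letI := layerQuotFintype κ n
    haveI := finite_oMuCarrier (K := K) S k
    galoisCohomology (((DiscreteGaloisModule.coind (coeffRepK S θ' P k) (κ.layerSubgroup n) (κ.isOpen_layerSubgroup n)).tateDual (p ^ k)).toLocal (Sum.inr w)) 1 :=
  letI := layerQuotFintype κ n
  haveI := finite_oMuCarrier (K := K) S k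
  galoisCohomology.localization ((DiscreteGaloisModule.coind (coeffRepK S θ' P k) (κ.layerSubgroup n) (κ.isOpen_layerSubgroup n)).tateDual (p ^ k)) (Sum.inr w) 1
    (cohomologyMap (coindTateDualMor (coeffRepK S θ' P k) (torsRep M hstabK p k) (κ.layerSubgroup n) (pairingB S θ' P M hstabK PG k)
      (κ.isOpen_layerSubgroup n) (pairingB_smul S θ' P M hstabK PG k)) 1
      (shapiroLift (torsRep M hstabK p k).toTopRep (κ.layerSubgroup n) (κ.isOpen_layerSubgroup n) (layerReps_spec κ n) (layerReps_one κ n) c))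

/-- **THE SEMILOCAL LEVEL PAIRING at `w`**: `⟨t, semilocDual c⟩_w ∈ ℤ/p^k` for a semilocal class `t ∈ Lloc_w(n,k)` and a global layer class `c ∈ H¹(U_n, M[p^k])` — THE canonical
local Tate pairing of the coinduced module `Maps(Γ_K ⧸ U_n, X_k)` at `w` (canonical invariant map). [cite: MilneADT2006, Ch. I, Cor. 2.3, Thm. 4.10] [cite: NeukirchSchmidtWingberg2008, (7.2.6), (8.6.2)] -/
def semilocPairNK (w : HeightOneSpectrum (𝓞 K)) (n k : ℕ) (t : semilocCoh S κ θ' P w n k 1)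
    (c : continuousCohomology 1 (subgroupRep (torsRep M hstabK p k).toTopRep (κ.layerSubgroup n))) : ZMod (p ^ k) :=
  letI := layerQuotFintype κ n
  haveI := finite_oMuCarrier (K := K) S k
  haveI : NeZero (p ^ k) := ⟨pow_ne_zero _ (Fact.out : p.Prime).ne_zero⟩
  localTatePairingZMod (DiscreteGaloisModule.coind (coeffRepK S θ' P k) (κ.layerSubgroup n) (κ.isOpen_layerSubgroup n)) (p ^ k) (Sum.inr w)
    (LocalInvariants.canonical K (p ^ k) (Sum.inr w)) t (semilocDual S κ θ' P M hstabK PG w n k c)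

end Pairing

/-! ## §2. N1 — one level, honda's dialect -/

section Level

variable {K : Type} [Field K] [NumberField K] {p : ℕ} [Fact p.Prime] (S : Set (PadicAlgCl p)) [FiniteDimensional ℚ_[p] (padicCoeffField S)] (κ : ZpExtension K p)
  (θ' : absoluteGaloisGroup K →ₜ* (padicCoeffIntegers S)ˣ) (P : Set (HeightOneSpectrum (𝓞 K))) (v : HeightOneSpectrum (𝓞 K))
  (M : Type) [AddCommGroup M] [TopologicalSpace M] [DiscreteTopology M] [DistribMulAction (absoluteGaloisGroup K) M] [Module (padicCoeffIntegers S) M]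
  (hstabK : ∀ m : M, IsOpen (MulAction.stabilizer (absoluteGaloisGroup K) m : Set (absoluteGaloisGroup K)))
  (PG : ∀ k : ℕ, ContPairing (coeffRepK S θ' P k).toTopRep (torsRep M hstabK p k).toTopRep (mu K (p ^ k)).toTopRep)

-- The base-field Poitou–Tate package speaks `galoisCohomology ((DiscreteGaloisModule.coind X U hU).toLocal (Sum.inr w)) 1` / `galoisCohomology.localization`, honda's tower speaks
-- `H¹(Γ_{K_w}, (coindFin X.toTopRep U)|_{res_w})` / `ContinuousCohomology.map res_w` (T1-a): two DEFINITIONALLY equal dialects (`toTopRep_coind`, `localization = res`) whose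
-- identification by `rfl` inside `exact` is expensive (as in H7c `…J3HSolLFree`, p802792); hence the raised heartbeat limit.
omit [Module (padicCoeffIntegers S) M] in
set_option maxHeartbeats 2000000 in
/-- ★★ **N1 — depleted Poitou–Tate existence at ONE level, in honda's dialect.** Let `P ⊆ S₀ ∪ {v}` with `v ∈ P ∖ S₀` the only place above `p`, `N_P ≤ U_n`, and let the level
pairing `PG k` be perfect on `M[p^k]`. If `t_w ∈ Lloc_w(n,k) = H¹(K_w, Maps(Γ_K ⧸ U_n, X_k))` (`w ∈ S₀`) satisfy `Σ_{w∈S₀} ⟨t_w, semilocDual c⟩_w = 0` for every global layer class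
`c ∈ H¹(U_n, M[p^k])` unramified off `S₀ ∪ {v}` whose dual class is orthogonal to all of `Lloc_v(n,k)` at `v`, and `t_w` is an unramified local class at each `w ∈ S₀ ∖ P`, then
`t_w = sloc_{w,n,k} yb` for all `w ∈ S₀` for some `yb ∈ H¹(G_P(K_n), X_k)`. (T3-finite p811420 on `X_k`, `M[p^k]`, `U_n`; the produced `y ∈ H¹(U_n, X_k)` is unramified off `S₀ ∪ {v}`
by construction and at `S₀ ∖ P` by the class-level transport of `t_w ∈ H¹_ur`; descend by honda's H1 and read through T1-a.) [cite: MilneADT2006, Ch. I, Thm. 4.10(b)]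
[cite: NeukirchSchmidtWingberg2008, I §6 Prop. (1.6.4), (8.6.2)–(8.6.3)] [cite: Rubin2000, Thm. 1.7.3] -/
theorem exists_cycLayer_forall_semilocNK_eq_of_orth (S₀ : Set (HeightOneSpectrum (𝓞 K))) (hS₀ : S₀.Finite) (hvS₀ : v ∉ S₀) (hvP : v ∈ P)
    (hPS₀ : ∀ w ∈ P, w ∉ S₀ → w = v) (hpv : ∀ w : HeightOneSpectrum (𝓞 K), ((p : ℕ) : 𝓞 K) ∈ w.asIdeal → w = v) (n k : ℕ)
    (hNP : ramificationSubgroup K P ≤ κ.layerSubgroup n) (hperf : Bijective fun a : ↥(torsionPow M p k) ↦ (PG k).toLin.flip a)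
    (t : ∀ w : HeightOneSpectrum (𝓞 K), semilocCoh S κ θ' P w n k 1)
    (hunr : letI := layerQuotFintype κ n
      haveI := finite_oMuCarrier (K := K) S k
      ∀ w ∈ S₀, w ∉ P → t w ∈ unramifiedSubgroup (GaloisRep.toLocal w (DiscreteGaloisModule.coind (coeffRepK S θ' P k) (κ.layerSubgroup n) (κ.isOpen_layerSubgroup n))) 1)
    (horth : ∀ c : continuousCohomology 1 (subgroupRep (torsRep M hstabK p k).toTopRep (κ.layerSubgroup n)),
      (∀ w : HeightOneSpectrum (𝓞 K), w ≠ v → w ∉ S₀ → ∀ 𝔓 ∈ w.primesAbove,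
        resLe (torsRep M hstabK p k).toTopRep (inf_le_left : κ.layerSubgroup n ⊓ 𝔓.inertia (absoluteGaloisGroup K) ≤ κ.layerSubgroup n) 1 c = 0) →
      (∀ a : semilocCoh S κ θ' P v n k 1, semilocPairNK S κ θ' P M hstabK PG v n k a c = 0) →
      ∑ w ∈ hS₀.toFinset, semilocPairNK S κ θ' P M hstabK PG w n k (t w) c = 0) :
    ∃ yb : cycLayerCohO S κ θ' P n k 1, ∀ w ∈ S₀, semilocNK S κ θ' P w n k yb = t w := by
  letI := layerQuotFintype κ n
  haveI : NeZero (p ^ k) := ⟨pow_ne_zero _ (Fact.out : p.Prime).ne_zero⟩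
  haveI := finite_oMuCarrier (K := K) S k
  have hvS₀' : v ∉ hS₀.toFinset := fun h ↦ hvS₀ (hS₀.mem_toFinset.mp h)
  -- `X_k` is killed by `p^k`; the places dividing `p^k` lie under `v`; `Maps(Γ_K ⧸ U_n, X_k)` is unramified off `P ⊆ S₀ ∪ {v}`
  have hMn : ∀ x : ↥(Representation.invariants ((muTwistO S θ' k).toRepresentation.comp (ramificationSubgroup K P).subtype)), (p ^ k) • x = 0 :=
    fun x ↦ by rw [← natCast_zsmul]; exact_mod_cast coeffGSO_torsion S P θ' k x
  have hn : ∀ w : HeightOneSpectrum (𝓞 K), ((p ^ k : ℕ) : 𝓞 K) ∈ w.asIdeal → w ∈ insert v hS₀.toFinset := fun w hw ↦ by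
    rw [Nat.cast_pow] at hw
    rw [hpv w (w.isPrime.mem_of_pow_mem k hw)]
    exact Finset.mem_insert_self _ _
  have hurP : ∀ w : HeightOneSpectrum (𝓞 K), w ∉ P →
      GaloisRep.IsUnramifiedAt w (DiscreteGaloisModule.coind (coeffRepK S θ' P k) (κ.layerSubgroup n) (κ.isOpen_layerSubgroup n)) := fun w hwP ↦
    SignedLowerOffTwo.PTDeep.isUnramifiedAt_coind _ _ _ (isUnramifiedAt_coeffRepK S θ' P k hwP)
      fun 𝔓 h𝔓 ↦ (inertia_le_ramificationSubgroup hwP h𝔓).trans hNP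
  have hnotP : ∀ w : HeightOneSpectrum (𝓞 K), w ∉ insert v hS₀.toFinset → w ∉ P := fun w hw hwP ↦ by
    have hwS : w ∉ S₀ := fun h ↦ hw (Finset.mem_insert_of_mem (hS₀.mem_toFinset.mpr h))
    exact hw ((hPS₀ w hwP hwS) ▸ Finset.mem_insert_self _ _)
  have hur : ∀ w : HeightOneSpectrum (𝓞 K), w ∉ insert v hS₀.toFinset →
      GaloisRep.IsUnramifiedAt w (DiscreteGaloisModule.coind (coeffRepK S θ' P k) (κ.layerSubgroup n) (κ.isOpen_layerSubgroup n)) := fun w hw ↦ hurP w (hnotP w hw)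
  -- T3-finite
  obtain ⟨y, hyS₀, hyur⟩ := exists_layer_forall_localization_shapiroLift_eq K (p ^ k) (coeffRepK S θ' P k) (torsRep M hstabK p k)
    (pairingB S θ' P M hstabK PG k) (pairingB_smul S θ' P M hstabK PG k) (κ.layerSubgroup n) (κ.isOpen_layerSubgroup n)
    (bijective_pairingB_flip S θ' P M hstabK PG k hperf) hMn (layerReps_spec κ n) (layerReps_one κ n) v hS₀.toFinset hvS₀' hn hur t
    (fun c hc hcv ↦ horth c (fun w hwv hwS ↦ hc w (by
        rw [Finset.mem_insert, not_or]; exact ⟨hwv, fun h ↦ hwS (hS₀.mem_toFinset.mp h)⟩)) hcv)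
  -- `y` is unramified at the places of `S₀ ∖ P` (its semilocalisation there is the unramified class `t_w`), hence off `P`
  have hyP : ∀ w : HeightOneSpectrum (𝓞 K), w ∉ P → ∀ 𝔓 ∈ w.primesAbove,
      resLe (coeffRepK S θ' P k).toTopRep (inf_le_left : κ.layerSubgroup n ⊓ 𝔓.inertia (absoluteGaloisGroup K) ≤ κ.layerSubgroup n) 1 y = 0 := by
    intro w hwP 𝔓 h𝔓
    by_cases hw : w ∈ S₀
    · refine SignedLowerOffTwo.PTDeep.resLe_inertia_eq_zero_of_localization_shapiroLift_mem (coeffRepK S θ' P k) (κ.layerSubgroup n)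
        (κ.isOpen_layerSubgroup n) (layerReps_spec κ n) (layerReps_one κ n) (hurP w hwP) y ?_ h𝔓
      rw [hyS₀ w (hS₀.mem_toFinset.mpr hw)]
      exact hunr w hw hwP
    · have hwv : w ≠ v := fun h ↦ hwP (h ▸ hvP)
      exact hyur w (by rw [Finset.mem_insert, not_or]; exact ⟨hwv, fun h ↦ hw (hS₀.mem_toFinset.mp h)⟩) 𝔓 h𝔓
  obtain ⟨yb, hyb⟩ := exists_inflNK_eq_of_resLe_inertia S κ θ' P n k hNP y hyP
  refine ⟨yb, fun w hw ↦ ?_⟩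
  rw [semilocNK_eq_map_shapiroLift S κ θ' P w n k (layerReps_spec κ n) (layerReps_one κ n) yb, hyb]
  exact hyS₀ w (hS₀.mem_toFinset.mpr hw)

end Level

/-! ## §3. N4 — the tower: Kőnig over the layer groups -/

section Tower

variable {K : Type} [Field K] [NumberField K] {p : ℕ} [Fact p.Prime] (S : Set (PadicAlgCl p)) [FiniteDimensional ℚ_[p] (padicCoeffField S)] (κ : ZpExtension K p)
  (θ' : absoluteGaloisGroup K →ₜ* (padicCoeffIntegers S)ˣ) (P : Set (HeightOneSpectrum (𝓞 K))) (v : HeightOneSpectrum (𝓞 K))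
  (M : Type) [AddCommGroup M] [TopologicalSpace M] [DiscreteTopology M] [DistribMulAction (absoluteGaloisGroup K) M] [Module (padicCoeffIntegers S) M]
  [DistribMulAction (absoluteGaloisGroup (v.adicCompletion K)) M] [SMulCommClass (absoluteGaloisGroup (v.adicCompletion K)) (padicCoeffIntegers S) M]
  (hstabK : ∀ m : M, IsOpen (MulAction.stabilizer (absoluteGaloisGroup K) m : Set (absoluteGaloisGroup K)))
  (PG : ∀ k : ℕ, ContPairing (coeffRepK S θ' P k).toTopRep (torsRep M hstabK p k).toTopRep (mu K (p ^ k)).toTopRep)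

omit [FiniteDimensional ℚ_[p] (padicCoeffField S)] [DistribMulAction (absoluteGaloisGroup K) M] in
/-- Sets of layer classes closed under honda's one-step transitions are closed under the iterated transitions of any finite-level socket `𝓛`. [folklore] -/
theorem mem_of_coresLE_redLE {γv : absoluteGaloisGroup (v.adicCompletion K)} {γ : absoluteGaloisGroup K} (𝓛 : LayerPairing S M γv κ γ θ' P)
    (A : ∀ n k : ℕ, Set (cycLayerCohO S κ θ' P n k 1))
    (hAc : ∀ (n k : ℕ) (y : cycLayerCohO S κ θ' P (n + 1) k 1), y ∈ A (n + 1) k → cycLayerCoresO S κ θ' P n k 1 y ∈ A n k)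
    (hAr : ∀ (n k : ℕ) (y : cycLayerCohO S κ θ' P n (k + 1) 1), y ∈ A n (k + 1) → cycLayerRedO S κ θ' P n k 1 y ∈ A n k)
    {n n' : ℕ} (hn : n ≤ n') {k k' : ℕ} (hk : k ≤ k') (y : cycLayerCohO S κ θ' P n' k' 1) (hy : y ∈ A n' k') :
    𝓛.coresLE hn k (𝓛.redLE n' hk y) ∈ A n k := by
  -- reduction first
  have hred : ∀ {k k' : ℕ} (hk : k ≤ k') (m : ℕ) (z : cycLayerCohO S κ θ' P m k' 1), z ∈ A m k' → 𝓛.redLE m hk z ∈ A m k := by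
    intro k k' hk m z hz
    induction k', hk using Nat.le_induction with
    | base => rwa [𝓛.redLE_refl]
    | succ k' hk ih =>
      rw [← 𝓛.redLE_trans m hk (Nat.le_succ k'), 𝓛.redLE_succ]
      exact ih _ (hAr m k' z hz)
  have hcores : ∀ {n n' : ℕ} (hn : n ≤ n') (k : ℕ) (z : cycLayerCohO S κ θ' P n' k 1), z ∈ A n' k → 𝓛.coresLE hn k z ∈ A n k := by
    intro n n' hn k z hz
    induction n', hn using Nat.le_induction with
    | base => rwa [𝓛.coresLE_refl]
    | succ n' hn ih =>
      rw [← 𝓛.coresLE_trans hn (Nat.le_succ n'), 𝓛.coresLE_succ]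
      exact ih _ (hAc n' k z hz)
  exact hcores hn k _ (hred hk n' y hy)

set_option maxHeartbeats 800000 in
/-- ★★★ **N4 — THE TOWER PASSAGE of the depleted Poitou–Tate existence.** Data: honda's cyclotomic Iwasawa module `I` over `P` (`N_P ≤ U_m` for all `m`), the semilocal Iwasawa
data `L_w` (T1-b₂) at the places `w`, any finite-level socket `𝓛` (only its transition maps are used — Kőnig), perfect level pairings `PG k`, `P` finite, `P ⊆ S₀ ∪ {v}`,
`v ∈ P ∖ S₀` the only place above `p`. HYPOTHESES on a family `h_w ∈ L_w.H = 𝐇¹_{Iw,w}` (`w ∈ S₀`): at every level `(n, k)`, (i) `Σ_{w∈S₀} ⟨proj_{n,k} h_w, semilocDual c⟩_w = 0` for every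
global layer class `c ∈ H¹(U_n, M[p^k])` unramified off `S₀ ∪ {v}` whose dual class is orthogonal to everything at `v` (levelwise orthogonality to the `v`-strict dual classes —
what membership in the kernel of the tower pairing against `Sel_{str,v}` supplies), and (ii) `proj_{n,k} h_w` is an unramified local class for `w ∈ S₀ ∖ P`. CONCLUSION: there is ONE
`b ∈ I.H` with `sloc_w b = h_w` for every `w ∈ S₀` — i.e. `h` lies in the image of `slocPi` (T2′), the exactness-at-`Hloc` half of the compact five-term sequence restricted to the
`(S₀ ∖ P)`-unramified classes. Proof: the level solution sets `A n k = {yb | ∀ w ∈ S₀, sloc_{w,n,k} yb = proj_{n,k} h_w}` are non-empty (§2), finite, and closed under the transitions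
(T1-b₁ + (P1)/(P2)); Kőnig (p783849) gives `b` with `proj_{n,k} b ∈ A n k` for all `n, k`; (P3) of `L_w`. [cite: Rubin2000, Thm. 1.7.3, Prop. B.1.1, App. B.3] [cite: MilneADT2006, Ch. I, Thm. 4.10(b)]
[cite: NeukirchSchmidtWingberg2008, (8.6.2)–(8.6.3)] [cite: Kato2004Asterisque, §8.2, §17.13] -/
theorem exists_forall_semilocMap_eq_of_forall_orth {γv : absoluteGaloisGroup (v.adicCompletion K)} {γ : absoluteGaloisGroup K} (𝓛 : LayerPairing S M γv κ γ θ' P)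
    (S₀ : Set (HeightOneSpectrum (𝓞 K))) (hS₀ : S₀.Finite) (hvS₀ : v ∉ S₀) (hvP : v ∈ P) (hP : P.Finite)
    (hPS₀ : ∀ w ∈ P, w ∉ S₀ → w = v) (hpv : ∀ w : HeightOneSpectrum (𝓞 K), ((p : ℕ) : 𝓞 K) ∈ w.asIdeal → w = v)
    (hNP : ∀ n, ramificationSubgroup K P ≤ κ.layerSubgroup n) (hperf : ∀ k : ℕ, Bijective fun a : ↥(torsionPow M p k) ↦ (PG k).toLin.flip a)
    (I : CycIwasawaCohomologyDataO S κ γ θ' P 1) (L : ∀ w : HeightOneSpectrum (𝓞 K), SemilocIwasawaCohomologyDataO S κ γ θ' P w 1)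
    (h : ∀ w : HeightOneSpectrum (𝓞 K), (L w).H)
    (hunr : ∀ n k : ℕ, letI := layerQuotFintype κ n
      haveI := finite_oMuCarrier (K := K) S k
      ∀ w ∈ S₀, w ∉ P → (L w).proj n k (h w) ∈ unramifiedSubgroup (GaloisRep.toLocal w (DiscreteGaloisModule.coind (coeffRepK S θ' P k) (κ.layerSubgroup n) (κ.isOpen_layerSubgroup n))) 1)
    (horth : ∀ (n k : ℕ) (c : continuousCohomology 1 (subgroupRep (torsRep M hstabK p k).toTopRep (κ.layerSubgroup n))),
      (∀ w : HeightOneSpectrum (𝓞 K), w ≠ v → w ∉ S₀ → ∀ 𝔓 ∈ w.primesAbove,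
        resLe (torsRep M hstabK p k).toTopRep (inf_le_left : κ.layerSubgroup n ⊓ 𝔓.inertia (absoluteGaloisGroup K) ≤ κ.layerSubgroup n) 1 c = 0) →
      (∀ a : semilocCoh S κ θ' P v n k 1, semilocPairNK S κ θ' P M hstabK PG v n k a c = 0) →
      ∑ w ∈ hS₀.toFinset, semilocPairNK S κ θ' P M hstabK PG w n k ((L w).proj n k (h w)) c = 0) :
    ∃ b : I.H, ∀ w ∈ S₀, semilocMap hNP I (L w) b = h w := by
  -- the level solution sets
  let A : ∀ n k : ℕ, Set (cycLayerCohO S κ θ' P n k 1) := fun n k ↦ {yb | ∀ w ∈ S₀, semilocNK S κ θ' P w n k yb = (L w).proj n k (h w)}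
  have hAc : ∀ (n k : ℕ) (y : cycLayerCohO S κ θ' P (n + 1) k 1), y ∈ A (n + 1) k → cycLayerCoresO S κ θ' P n k 1 y ∈ A n k := fun n k y hy w hw ↦ by
    rw [semilocNK_cores S κ θ' P w hNP n k y, hy w hw, (L w).proj_cores]
  have hAr : ∀ (n k : ℕ) (y : cycLayerCohO S κ θ' P n (k + 1) 1), y ∈ A n (k + 1) → cycLayerRedO S κ θ' P n k 1 y ∈ A n k := fun n k y hy w hw ↦ by
    rw [semilocNK_red S κ θ' P w n k y, hy w hw, (L w).proj_red]
  have hne : ∀ m : ℕ, (A m m).Nonempty := fun m ↦ by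
    obtain ⟨yb, hyb⟩ := exists_cycLayer_forall_semilocNK_eq_of_orth S κ θ' P v M hstabK PG S₀ hS₀ hvS₀ hvP hPS₀ hpv m m (hNP m) (hperf m)
      (fun w ↦ (L w).proj m m (h w)) (hunr m m) (horth m m)
    exact ⟨yb, hyb⟩
  obtain ⟨b, hb⟩ := LayerPairing.exists_proj_mem_of_forall_nonempty 𝓛 (I := I) (fun n k ↦ finite_cycLayerCohO_one S θ' P κ hP n k) A
    (fun {n n'} hn {k k'} hk y hy ↦ mem_of_coresLE_redLE S κ θ' P v M 𝓛 A hAc hAr hn hk y hy) hne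
  refine ⟨b, fun w hw ↦ ((L w).eq_of_forall_proj_eq fun n k ↦ ?_).symm⟩
  rw [proj_semilocMap]
  exact (hb n k w hw).symm

end Tower

end Summit.BirchSwinnertonDyer.BirchSwinnertonDyer.Theorems.SmallImageRttD2Seq

end
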